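import Mathlib
import HarnessLib
import Literature.MathematicalPhysics.QuantumLattice.GrassmannLaplacian
import Summits.HubbardSuperconductivity.HubbardSuperconductivity.Theorems.KLProgrammeKLRegimeSplitPredicatesV3

/-!
# Route `KLProgramme` — crux K3 split, one supplier arrow of the V3 map made formal: the running coupling VALUE at pair
# kinematics IS the pair amplitude (`klQuarticValue … n ↑ ↓ k′ k (Q − k′) = klPairAmplitude … n Q k k′`), hence
# `PairArrayAt` (B1-v2) supplies `QuarticValueLine` on pair-class configurations (cell gate-hubbard-kl, seat p1 = C1 lead, g5)

The two carriers of `KLProgrammeKLRegimeSplitPredicatesV2/V3` read the same four-point vertex function (`vertexFn … 4`) on label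
tuples that differ by the EVEN permutation `(1 3 2)` of the legs (BGM field order `ψ⁺ψ⁻ψ⁺ψ⁻` vs the pair order `ψ⁺ψ⁺ψ⁻ψ⁻` of
`cooperAmplitude`); Grassmann kernels are totally antisymmetric (`grassmannDeriv_mul_comm`: fermionic derivatives anticommute),
so the two values agree.  Then `PairArrayAt … n` (`∃ u ∈ [0, 2|U|]`, `|𝒞_n(Q;k,k′) − u| ≤ C_W U²`) bounds the running coupling value
at every pair configuration by `2|U| + C_W U²` — the pair-class row of the V3 supplier map («`QuarticValueLine` ⇐ `PairArrayAt`»).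
Pure bookkeeping; nothing about the model is asserted.
-/

noncomputable section

namespace Summit.HubbardSuperconductivity.HubbardSuperconductivity.Theorems.KLRegimeSplit

set_option linter.dupNamespace false -- summit = problem name (single-conjunct summit), D-0017

open Literature.MathematicalPhysics.QuantumLattice Literature.Probability.LatticeModels GrassmannAlgebra
open Summit.HubbardSuperconductivity.HubbardSuperconductivity.Theorems.KLProgrammeLegKernels

/-- The iterated derivative of an explicit 4-tuple of labels: `∂_d ∂_c ∂_b ∂_a` (last label outermost). -/
theorem iterDeriv_vec4 {R : Type*} [CommRing R] [Algebra ℚ R] {Γ : Type*} (a b c d : Γ) :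
    iterDeriv R ![a, b, c, d] = grassmannDeriv R d * grassmannDeriv R c * grassmannDeriv R b * grassmannDeriv R a := by
  simp [iterDeriv, List.ofFn_succ, mul_assoc]

/-- **Antisymmetry for the even leg permutation `(1 3 2)`**: `kernel F 4 [a, d, b, c] = kernel F 4 [a, b, c, d]` (two
anticommutations of fermionic derivatives). -/
theorem kernel_four_cycle {R : Type*} [CommRing R] [Algebra ℚ R] {Γ : Type*} (F : GrassmannAlgebra R Γ) (a b c d : Γ) :
    kernel R F 4 ![a, d, b, c] = kernel R F 4 ![a, b, c, d] := by
  rw [kernel_def, kernel_def, iterDeriv_vec4, iterDeriv_vec4]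
  congr 2
  simp only [Module.End.mul_apply]
  -- `∂_c (∂_b (∂_d y)) = ∂_d (∂_c (∂_b y))`, `y = ∂_a F`
  rw [grassmannDeriv_grassmannDeriv_comm R b d, map_neg, grassmannDeriv_grassmannDeriv_comm R c d, neg_neg]

section Model

variable (L M : ℕ) [NeZero L] [NeZero M]

/-- **The running coupling value at pair kinematics is the pair amplitude**: for spins `(↑, ↓) = (0, 1)` and momenta
`(k₁, k₂, k₃) = (k′, k, Q − k′)` (so that `k₄ = k′ − k + (Q − k′) = Q − k`),
`klQuarticValue … n 0 1 k′ k (Q − k′) = klPairAmplitude … n Q k k′`. -/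
theorem klQuarticValue_pair (β U μ : ℝ) (K : TrigPolyC4v) (n : ℕ) (Q k k' : TorusSite 2 L) :
    klQuarticValue L M β U μ K n 0 1 k' k (Q - k') = klPairAmplitude L M β U μ K n Q k k' := by
  have hk : k' - k + (Q - k') = Q - k := by abel
  simp only [klQuarticValue, klPairAmplitude, vertexFn, hk]
  congr 1
  exact kernel_four_cycle _ _ _ _ _

/-- **`PairArrayAt` supplies the value line at pair kinematics**: if (B1-v2) holds at scale `n`, then for every total momentum `Q`
and all momenta `k, k′` of the ball, `|λ_n^{↑↓}(k′, k, Q − k′)| ≤ 2|U| + C_W·U²`. -/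
theorem quarticValue_pair_le_of_pairArrayAt (P : SplitConsts) {β U μ : ℝ} {K : TrigPolyC4v} {n : ℕ}
    (h : PairArrayAt L M P β U μ K n) (Q : TorusSite 2 L) {k k' : TorusSite 2 L} (hk : k ∈ klBall L μ K)
    (hk' : k' ∈ klBall L μ K) :
    ‖klQuarticValue L M β U μ K n 0 1 k' k (Q - k')‖ ≤ 2 * |U| + P.C_W * U ^ 2 := by
  obtain ⟨u, hu0, hu2, hdev⟩ := h Q
  rw [klQuarticValue_pair]
  have hd := hdev k hk k' hk'
  calc ‖klPairAmplitude L M β U μ K n Q k k'‖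
      = ‖(klPairAmplitude L M β U μ K n Q k k' - (u : ℂ)) + (u : ℂ)‖ := by rw [sub_add_cancel]
    _ ≤ ‖klPairAmplitude L M β U μ K n Q k k' - (u : ℂ)‖ + ‖(u : ℂ)‖ := norm_add_le _ _
    _ ≤ P.C_W * U ^ 2 + 2 * |U| := by
        rw [Complex.norm_real, Real.norm_eq_abs, abs_of_nonneg hu0]; exact add_le_add hd hu2
    _ = 2 * |U| + P.C_W * U ^ 2 := by ring

end Model

end Summit.HubbardSuperconductivity.HubbardSuperconductivity.Theorems.KLRegimeSplit

end
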